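import Literature.MathematicalPhysics.QuantumFieldTheory.QuasiLocalGaugePerturbation
import Literature.MathematicalPhysics.QuantumFieldTheory.TorusPlaquetteNeighbours
import Literature.Probability.LatticeModels.DobrushinComparisonMetric
import Mathlib.Probability.Moments.Covariance
import HarnessLib

/-!
# YM₃ infrared statement — part 1 `YM3IR/Clustering.lean`: the clustering currency, the target
`MassGap3`, block families, and the receiving interface for track Y2's cluster domain
(cell `pub-ymgap`, track Y4, ym3ir-theory-2; part 2 = `YM3IR/Statement.lean`, UV side = `YM3IR/UVInterface.lean`)

HONEST FRAMING. This file TYPES definitions and two conjecture-labelled targets; it proves only a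
monotonicity lemma. It is NOT a proof of a mass gap for YM₃, not a claim that any statement below
holds, and not a Clay-problem / summit statement. No axiom, no `sorry`.

WHAT IT SAYS. (1) The clustering currency `ClustersWith r μ A m` / `UniformClustering r fam m` —
VERBATIM the body of track Y2's `RobustBall.TorusClusteringOnBall` (coordinatewise `r`-Lipschitz
bounded cylinder observables, `|cov| ≤ A (Σδf)(Σδg) e^{−m n}`, one constant for all tori of side
`M ≥ 3`), with the link metric `r` a parameter (`r ≡ 1` = oscillation form). (2) The TARGET
`MassGap3 r ρ` (CONJECTURE): the `d = 3` Wilson theory at bare coupling `β ≥ β₁` clusters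
volume-uniformly at rate `m₀/β` in lattice units — a physical mass `∝ g²` uniform in the spacing
(`β ∝ 1/(g²ε)`, super-renormalisable scaling). (3) Block families `BlockFamily` (block factor `b(β)`,
measurable block maps; the intended CONSTRUCTION is Bałaban's covariant averaging, CMP 98 (1985)),
the coarse laws `coarseFamily` (push-forwards of the fine Wilson laws), and the receiving interface
`BallSpec` / `BallSpec.Mem` for Y2's ball on the TREE carrier `QuasiLocalGaugePerturbation 3 M G 1`
(membership `InBall` abstract until `RobustBall.ClusterDomain κ ε₀ ε₁` is in the tree), with Y2's
deliverable in this currency, `ClusterDomainClustering` (Y2's theorem-to-be; Wilson member in print: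
Osterwalder–Seiler 1978 §3).

WHY THIS IS NOVEL (one sentence). Fixing ONE currency shared verbatim with the strong-coupling track
and ONE carrier shared with Bałaban's effective-action format is what lets the d = 3 infrared theorem
of part 2 be stated as two named conjectures about one block map and composed with the printed UV
theorem by kernel-checked plumbing — nobody has written the YM₃ hand-over down with carriers and units
fixed (companion records: HOME/ym3ir/AS-PRINTED.md, YM3-IR.md of cell pub-ymgap).

## References (as printed; page/line records by ym3ir-lit, AS-PRINTED.md)

* K. Osterwalder, E. Seiler, *Gauge field theories on a lattice*, Ann. Phys. 110 (1978) 440–471, §§2–3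
  (reflection positivity; strong-coupling cluster expansion, volume-uniform clustering). [cite: OsterwalderSeiler1978]
* T. Bałaban, *Averaging operations for lattice gauge theories*, CMP 98 (1985) 17–51, (10), (15). [cite: Balaban1985Averaging]
* T. Bałaban, *Ultraviolet stability of three-dimensional lattice pure gauge field theories*, CMP 102
  (1985) 255–275, (2) p. 256 (the densities `ρ_k`). [cite: Balaban1985UV3]
* T. Bałaban, *Convergent renormalization expansions for lattice gauge theories*, CMP 119 (1988)
  243–285, p. 259 (2.25)–(2.28) (format of localized terms = the tree's `QuasiLocalGaugePerturbation`). [cite: Balaban1988Convergent]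
* H. Föllmer, *Random fields and diffusion processes*, LNM 1362 (1988) Ch. I (2.17)–(2.21)
  (coordinatewise Lipschitz constants; the tree's `DobrushinMetric.IsLipBound`). [cite: Follmer1988]
* K. Wilson, *Confinement of quarks*, Phys. Rev. D 10 (1974) 2445 (the action). [cite: Wilson1974]
-/


noncomputable section

open MeasureTheory ProbabilityTheory Filter Topology Finset
open Literature.Probability.LatticeModels Literature.Probability.LatticeModels.DobrushinMetric
open Literature.MathematicalPhysics.QuantumLattice
open Literature.MathematicalPhysics.QuantumFieldTheory

namespace Summit.Ventures.YMGap.YM3IR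

variable {d : ℕ} {G : Type} [MeasurableSpace G]

/-! ## 1. The clustering currency (generic dimension `d`; = the shape of Y2's `TorusClusteringOnBall`) -/

variable (d G) in
/-- A volume-indexed family of finite-volume laws (one law on the torus of every side `M ≥ 1`). -/
abbrev TorusFamily : Type :=
  (M : ℕ) → [NeZero M] → Measure (GaugeConfig d M G)

/-- **`ClustersWith r μ A m`: the law `μ` on the torus of side `M` clusters at rate `m` with constant
`A`, in the link metric `r`.** For bounded measurable cylinder observables `f, g` with edge supports
`Δf, Δg` at torus sup-distance `≥ n` and coordinatewise `r`-Lipschitz bounds `δf, δg`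
(`DobrushinMetric.IsLipBound`, Föllmer (2.17)): `|cov(f, g)| ≤ A (Σ δf)(Σ δg) e^{−m n}`. With
`r ≡ 1` the Lipschitz bounds are oscillation bounds, i.e. this is then clustering for ALL bounded
cylinder observables (`IsLipBound.isLipBound_one_iff`); with `r = suFrobDist` on `SU(N)` it is
VERBATIM the body of Y2's `RobustBall.TorusClusteringOnBall` (rb-theory, RobustBallDefs.lean). [cite: Follmer1988, Ch. I (2.17)] -/
def ClustersWith {M : ℕ} [NeZero M] (r : G → G → ℝ) (μ : Measure (GaugeConfig d M G)) (A m : ℝ) :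
    Prop :=
  ∀ (f g : GaugeConfig d M G → ℝ) (Δf Δg : Finset (Edge d M)) (δf δg : Edge d M → ℝ) (n : ℕ),
    Measurable f → Measurable g → DependsOn f (↑Δf : Set (Edge d M)) →
    DependsOn g (↑Δg : Set (Edge d M)) → (∃ C, ∀ U, |f U| ≤ C) → (∃ C, ∀ U, |g U| ≤ C) →
    IsLipBound r f δf → IsLipBound r g δg →
    (∀ x ∈ Δf, ∀ y ∈ Δg, n ≤ torusNorm (x.1 - y.1)) →
      |cov[f, g; μ]| ≤ A * (∑ x ∈ Δf, δf x) * (∑ y ∈ Δg, δg y) * Real.exp (-m * n)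

/-- **Volume-uniform exponential clustering at rate `m`** of a torus family: ONE constant `A` serves
every torus of side `M ≥ 3` (Y2's side condition). This is the currency of a lattice mass gap: by
reflection positivity of the Wilson action, clustering of a dense class of local observables at
rate `m` uniformly in the volume puts the transfer-matrix spectrum of each in `{1} ∪ [−e^{−m}, e^{−m}]`. [cite: OsterwalderSeiler1978, §§2–3] -/
def UniformClustering (r : G → G → ℝ) (fam : TorusFamily d G) (m : ℝ) : Prop :=
  ∃ A : ℝ, ∀ (M : ℕ) [NeZero M], 3 ≤ M → ClustersWith r (fam M) A m

/-- Clustering at rate `m` implies clustering at every smaller rate `m' ≤ m` (bookkeeping). -/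
theorem UniformClustering.mono {r : G → G → ℝ} {fam : TorusFamily d G} {m m' : ℝ} (hle : m' ≤ m)
    (h : UniformClustering r fam m) : UniformClustering r fam m' := by
  obtain ⟨A, hA⟩ := h
  refine ⟨max A 0, fun M _ hM f g Δf Δg δf δg n hf hg hdf hdg hbf hbg hlf hlg hn => ?_⟩
  have h0 := hA M hM f g Δf Δg δf δg n hf hg hdf hdg hbf hbg hlf hlg hn
  have hδf : 0 ≤ ∑ x ∈ Δf, δf x := sum_nonneg fun x _ => hlf.nonneg x
  have hδg : 0 ≤ ∑ y ∈ Δg, δg y := sum_nonneg fun y _ => hlg.nonneg y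
  have hn0 : (0 : ℝ) ≤ n := Nat.cast_nonneg n
  have hexp : Real.exp (-m * n) ≤ Real.exp (-m' * n) := Real.exp_le_exp.mpr (by nlinarith)
  have h1 : A * (∑ x ∈ Δf, δf x) * (∑ y ∈ Δg, δg y) ≤ max A 0 * (∑ x ∈ Δf, δf x) * (∑ y ∈ Δg, δg y) :=
    mul_le_mul_of_nonneg_right (mul_le_mul_of_nonneg_right (le_max_left _ _) hδf) hδg
  have h2 : 0 ≤ max A 0 * (∑ x ∈ Δf, δf x) * (∑ y ∈ Δg, δg y) :=
    mul_nonneg (mul_nonneg (le_max_right _ _) hδf) hδg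
  calc |cov[f, g; fam M]| ≤ A * (∑ x ∈ Δf, δf x) * (∑ y ∈ Δg, δg y) * Real.exp (-m * n) := h0
    _ ≤ max A 0 * (∑ x ∈ Δf, δf x) * (∑ y ∈ Δg, δg y) * Real.exp (-m * n) :=
        mul_le_mul_of_nonneg_right h1 (Real.exp_nonneg _)
    _ ≤ max A 0 * (∑ x ∈ Δf, δf x) * (∑ y ∈ Δg, δg y) * Real.exp (-m' * n) :=
        mul_le_mul_of_nonneg_left hexp h2

/-! ## 2. The target: the lattice YM₃ mass gap (CONJECTURE — the statement to be reached) -/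

section Target

variable {N : ℕ} [Group G] [TopologicalSpace G] [IsTopologicalGroup G] [CompactSpace G]
  [BorelSpace G]

/-- The finite-volume Wilson laws of `d = 3` lattice gauge theory in the representation `ρ` at bare
coupling `β` (the tree's `wilsonMeasure`, weight `exp(−β Σ_p Re tr(1 − ρ(U_p)))`), one per torus
side `M`. DICTIONARY (docstring only; theory-1's `Dictionary` proves the arithmetic): for
`G = SU(N)`, `ρ` fundamental, `β = β_W/N` with the standard `β_W = 2N/(g² ε)` at lattice spacing
`ε`; Bałaban's `1/g_ε² = 1/(g² ε)` (CMP 102 (1)) is `β` up to the `N`-dependent trace normalisation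
(theory-1's F11 reading). Only `β ∝ 1/(g²ε)` matters below. [cite: Wilson1974] -/
def wilsonFamily3 (ρ : G →* Matrix (Fin N) (Fin N) ℂ) (β : ℝ) : TorusFamily 3 G :=
  fun M _ => wilsonMeasure (d := 3) (L := M) ρ β

/-- **`LatticeMassGap3 r ρ m₀ β₁` (CONJECTURE; target).** For every bare coupling `β ≥ β₁` the
`d = 3` Wilson theory clusters volume-uniformly at rate `m₀/β` in lattice units
(`UniformClustering` in the link metric `r`): the correlation length grows at most linearly in
`β`, i.e. the physical mass is `≥ m₀'·g²` uniformly in the lattice spacing. Known IN PRINT only at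
strong coupling (`β ≤ β⋆`: Osterwalder–Seiler 1978 §3; the cell's certified windows), with a
`β`-independent rate. [cite: OsterwalderSeiler1978, §3] -/
@[conjecture] def LatticeMassGap3 (r : G → G → ℝ) (ρ : G →* Matrix (Fin N) (Fin N) ℂ)
    (m₀ β₁ : ℝ) : Prop :=
  ∀ β : ℝ, β₁ ≤ β → UniformClustering r (wilsonFamily3 ρ β) (m₀ / β)

/-- **`MassGap3 r ρ` (CONJECTURE; the lattice form of «YM₃ has a mass gap»):** some `m₀ > 0` and
`β₁` with `LatticeMassGap3 r ρ m₀ β₁`. A continuum statement additionally needs `ContinuumLimit3`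
(§6), which is NOT in print. [cite: OsterwalderSeiler1978, §§2–3] -/
@[conjecture] def MassGap3 (r : G → G → ℝ) (ρ : G →* Matrix (Fin N) (Fin N) ℂ) : Prop :=
  ∃ m₀ : ℝ, 0 < m₀ ∧ ∃ β₁ : ℝ, LatticeMassGap3 r ρ m₀ β₁

end Target

/-! ## 3. Block maps, coarse laws, and the receiving interface for Y2's `ClusterDomain` -/

variable (G) in
/-- **A family of block maps** (the object `T_IR` talks about). For every bare coupling `β` a block
factor `b(β) ≥ 1` and, for every coarse torus side `M`, a measurable map from fine configurations
on the torus of side `b(β)·M` to coarse configurations on the torus of side `M`. Bałaban's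
`(K+M')`-fold iterated averaging `U ↦ Ū` (CMP 98 (1985) (10), (15); block size `L`,
`b = L^{K+M'}`) is the intended CONSTRUCTION (a separate statement, theory-1's side of the seam);
gauge covariance and locality of the maps are properties of that construction, not needed for any
statement below to type-check. [cite: Balaban1985Averaging, (10) and (15)] -/
structure BlockFamily : Type where
  /-- the linear block factor `b(β)` (fine sites per coarse site, per direction) -/
  factor : ℝ → ℕ
  factor_pos : ∀ β, 0 < factor β
  /-- the block map at coupling `β` onto the coarse torus of side `M` -/
  blk : (β : ℝ) → (M : ℕ) → GaugeConfig 3 (factor β * M) G → GaugeConfig 3 M G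
  measurable_blk : ∀ β M, Measurable (blk β M)

/-- The fine torus side `b(β)·M` is nonzero (instance, so that `wilsonMeasure` on it makes sense). -/
instance BlockFamily.neZero_mul (W : BlockFamily G) (β : ℝ) (M : ℕ) [NeZero M] :
    NeZero (W.factor β * M) :=
  ⟨Nat.mul_ne_zero (W.factor_pos β).ne' (NeZero.ne M)⟩

/-- The coarse site (block label) of a fine site under block factor `b`: coordinatewise
`⌊x_i / b⌋` on canonical representatives. [folklore] -/
def blockOf (b M : ℕ) (x : Site d (b * M)) : Site d M :=
  fun i => (((x i).val / b : ℕ) : ZMod M)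

section Coarse

variable {N : ℕ} [Group G] [TopologicalSpace G] [IsTopologicalGroup G] [CompactSpace G]
  [BorelSpace G]

/-- The COARSE (effective) laws: push-forwards of the fine Wilson laws at coupling `β` on the tori
of side `b(β)·M` under the block maps — Bałaban's `ρ_k(V) dV` read as a probability law on coarse
configurations (CMP 102 (2), up to the gauge fixing inside `T`; this reading is the carrier seam,
M3). [cite: Balaban1985UV3, (2) p.256] -/
def coarseFamily (ρ : G →* Matrix (Fin N) (Fin N) ℂ) (β : ℝ) (W : BlockFamily G) :
    TorusFamily 3 G :=
  fun M _ => (wilsonMeasure (d := 3) (L := W.factor β * M) ρ β).map (W.blk β M)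

variable (G N) in
/-- **INTERFACE for Y2's ball.** The carrier is the TREE's `QuasiLocalGaugePerturbation 3 M G 1`
(polymer activities `W_X` on site sets, Bałaban CMP 119 (2.25)–(2.28)); the only abstract datum is
the MEMBERSHIP predicate `InBall M W` — instantiated at merge by rb-theory's tier-2
`W ∈ RobustBall.ClusterDomain κ ε₀ ε₁` (κ-weighted per-link oscillation / Lipschitz loads; its
parameters are folded into the instance) — together with the Wilson-part ceiling `βstar` and the
representation `ρ`. An instance is a CONSTRUCTION; nothing is assumed about it here. [cite: Balaban1988Convergent, p. 259 (2.25)–(2.28)] -/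
structure BallSpec : Type 1 where
  /-- the representation in the Wilson part of the action (fundamental of `SU(N)` for Y2) -/
  ρ : G →* Matrix (Fin N) (Fin N) ℂ
  /-- ceiling of the Wilson-part coupling of members (Y2's certified `β⋆`) -/
  βstar : ℝ
  /-- membership of the perturbation in Y2's ball, per torus side -/
  InBall : (M : ℕ) → [NeZero M] → QuasiLocalGaugePerturbation 3 M G 1 → Prop

/-- **`B.Mem M μ`: the law `μ` on the torus of side `M` IS a member of the cluster domain** —
`μ = Z⁻¹ exp(−β' S_Wilson − Σ_X W_X) ∏ dU` (`QuasiLocalGaugePerturbation.perturbedMeasure`) for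
some `0 ≤ β' ≤ β⋆` and some `W` in the ball (theory-1 ↔ rb-theory 19:07Z: this is the agreed
instantiation sentence). [cite: Balaban1988Convergent, p. 258 (2.23)] -/
def BallSpec.Mem (B : BallSpec G N) (M : ℕ) [NeZero M] (μ : Measure (GaugeConfig 3 M G)) : Prop :=
  ∃ β' : ℝ, 0 ≤ β' ∧ β' ≤ B.βstar ∧ ∃ W : QuasiLocalGaugePerturbation 3 M G 1,
    B.InBall M W ∧ μ = W.perturbedMeasure B.ρ β'

/-- **`ClusterDomainClustering B r m_c` — Y2's deliverable in the currency `T_IR` consumes.** ONE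
constant `A` such that every member law on every torus of side `M ≥ 3` `ClustersWith r _ A m_c`:
constants depend on the ball only — NOT on the volume, NOT on the member, NOT on `β' ≤ β⋆`
(Dobrushin-type constants are monotone in `β'`). For `r = suFrobDist` this is implied VERBATIM by
rb-theory's `TorusClusteringOnBall N 3 β' ε₀ ε₁ r A m_c` (uniformly in `β' ≤ β⋆`); IN PRINT for
the Wilson member (`W = 0`): Osterwalder–Seiler 1978 §3. [cite: OsterwalderSeiler1978, §3] -/
@[conjecture] def ClusterDomainClustering (B : BallSpec G N) (r : G → G → ℝ) (m_c : ℝ) : Prop :=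
  ∃ A : ℝ, ∀ (M : ℕ) [NeZero M], 3 ≤ M → ∀ μ : Measure (GaugeConfig 3 M G), B.Mem M μ →
    ClustersWith r μ A m_c

end Coarse

end Summit.Ventures.YMGap.YM3IR

end
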